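import Summits.Ventures.LatticeQCDFlow.TrivializingMaps.AnnealingSufficiencyAnyGroup

/-!
HONEST FRAMING: exact (Metropolis-corrected) sampling algorithms for lattice gauge theory; figures
of merit are autocorrelation/cost numbers at stated couplings and volumes; no continuum-physics
claim.

# CouplingKLAnyGroup — THE RELATIVE ENTROPY BETWEEN TWO COUPLINGS OF THE WILSON MEASURE IS THE
# BREGMAN DIVERGENCE OF `log Z`; JEFFREYS IDENTITY `D(μ_a‖μ_b) + D(μ_b‖μ_a) = (b−a)·(⟨S⟩_a − ⟨S⟩_b)`;
# ALONG UNIFORM ANNEALING THE SYMMETRISED ENTROPIES SUM TO `δ·(⟨S⟩_a − ⟨S⟩_b) ≤ 2N·#plaq·δ`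
# (every compact gauge group; lean-2 GEN-10, ours)

Venture-side (OURS).  Cell `lqcd-flow` (pub-lqcd), unit `pub-lqcd-lean-2-g10`, 2026-08-23.  The
MEASURE-LEVEL dictionary entry behind theory2's finite-state annealing-step / Jeffreys laws (T2-AC, T2-AD,
`Scaling/AnnealingStepLaw`, `Exactness/QuasiStaticFloorLaw.sum_klFin_add_klFin_symm`), for the actual Wilson
measures `μ_t = wilsonMeasure ρ t` of ANY compact second-countable gauge group `G` and any continuous
representation `ρ` on the torus `(ℤ/L)^d` (`ψ = cgf(−S_W^ρ)` under `D[U]`, `ψ′(t) = −⟨S_W⟩_t`,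
`ψ″ = Var`, `AnnealingSufficiencyAnyGroup`):

* §1 **`llr_wilsonMeasure_ae_eq`**: `log(dμ_a/dμ_b) = (b − a)·S_W + ψ(b) − ψ(a)` `μ_a`-a.e. (Mathlib's
  `llr_tilted_left/right`); **`toReal_klDiv_wilsonMeasure`**: `D(μ_a ‖ μ_b) = ψ(b) − ψ(a) + (b−a)·⟨S_W⟩_a
  = ψ(b) − ψ(a) − (b − a)·ψ′(a)` — the BREGMAN divergence of the convex free energy (`…_eq_bregman`), finite
  (`klDiv_wilsonMeasure_ne_top`), `= ∫_a^b (ψ′(s) − ψ′(a)) ds` (`…_eq_integral`).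
* §2 **`jeffreys_wilsonMeasure`**: `D(μ_a‖μ_b) + D(μ_b‖μ_a) = (b − a)·(ψ′(b) − ψ′(a)) = (b − a)·(⟨S⟩_a − ⟨S⟩_b)
  = (b − a)·∫_a^b Var_t dt` for ALL real `a, b` (exact); hence each of the two relative entropies is
  `≤ (b − a)·(⟨S⟩_a − ⟨S⟩_b)` (all `a, b`) `≤ 2N·#plaq·(b − a)` (`a ≤ b`) (`klDiv_wilsonMeasure_le_mean_drop`, `…_le_volume`,
  and the heating direction `klDiv_wilsonMeasure_symm_le_…`); with a variance floor `m` / ceiling `M` on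
  `[a, b]`: `m(b−a)² ≤ J(μ_a, μ_b) ≤ M(b−a)²` (`jeffreys_ge_of_floor`, `jeffreys_le_of_ceiling`).
* §3 **`sum_jeffreys_uniform`**: along the uniform schedule `β_j = a + jδ` the symmetrised step entropies
  TELESCOPE EXACTLY: `Σ_{j<k} J(μ_{β_j}, μ_{β_{j+1}}) = δ·(⟨S⟩_a − ⟨S⟩_{a+kδ})`, hence `≤ 2N·#plaq·δ`
  (`sum_jeffreys_uniform_le_volume`, `δ ≥ 0`) — the entropic twin of `uniform_schedule_cost_le_volume`
  (there: `χ²`/weight second moments, the ESS currency; here: relative entropies, the acceptance / KL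
  currency of the venture's `Acceptance*` and `EntropyBudget*` files).

NOT CLAIMED: total-variation or acceptance numbers (a measure-level Pinsker / IMH-acceptance functional is not
used here); finite-sample statements; anything about flows, autocorrelations or the continuum.  Literature
grade (cell rule): elementary (exponential-family identities: Kullback 1959; Amari–Nagaoka, *Methods of
Information Geometry* §3.4 — KL of an exponential family is the Bregman divergence of its log-partition
function); new typing for lattice gauge theory with a general compact group.
-/

noncomputable section

open MeasureTheory ProbabilityTheory Set intervalIntegral InformationTheory
open Literature.MathematicalPhysics.QuantumFieldTheory
open Literature.MathematicalPhysics.QuantumFieldTheory.Luscher2010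
open scoped Matrix Matrix.Norms.Frobenius ContDiff

namespace Summit.Ventures.LatticeQCDFlow.TrivializingMaps

section AnyGroup

variable {d L N : ℕ} [NeZero L] {G : Type*} [Group G] [TopologicalSpace G] [IsTopologicalGroup G]
  [CompactSpace G] [MeasurableSpace G] [BorelSpace G] [SecondCountableTopology G]
  (ρ : G →* Matrix (Fin N) (Fin N) ℂ)

/-! ## §1 `log(dμ_a/dμ_b)` and `D(μ_a ‖ μ_b)` as a Bregman divergence of `ψ = log Z` -/

/-- `e^{t·(−S_W)}` is `D[U]`-integrable (bounded continuous on a compact space). [folklore] -/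
theorem integrable_exp_mul_neg_wilsonAction (hρ : Continuous ρ) (t : ℝ) :
    Integrable (fun U : GaugeConfig d L G => Real.exp (t * (-wilsonAction ρ U))) (trivialMeasure G d L) :=
  integrable_trivialMeasure_of_continuous_group
    (Real.continuous_exp.comp (continuous_const.mul (continuous_wilsonAction_of_continuous ρ hρ).neg))

/-- **THE LOG-LIKELIHOOD RATIO OF TWO COUPLINGS**: `log(dμ_a/dμ_b)(U) = (b − a)·S_W(U) + ψ(b) − ψ(a)`
for `μ_a`-a.e. `U` (`ψ = cgf(−S_W^ρ)` under `D[U]`). [folklore] -/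
theorem llr_wilsonMeasure_ae_eq (hρ : Continuous ρ) (a b : ℝ) :
    llr (wilsonMeasure (d := d) (L := L) ρ a) (wilsonMeasure (d := d) (L := L) ρ b)
      =ᵐ[wilsonMeasure (d := d) (L := L) ρ a] fun U =>
        (b - a) * wilsonAction ρ U +
          (cgf (fun U => -wilsonAction ρ U) (trivialMeasure G d L) b -
            cgf (fun U => -wilsonAction ρ U) (trivialMeasure G d L) a) := by
  set D := trivialMeasure G d L with hD
  haveI : IsProbabilityMeasure D := by rw [hD]; unfold trivialMeasure; infer_instance
  set fa : GaugeConfig d L G → ℝ := fun U => a * (-wilsonAction ρ U) with hfa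
  set fb : GaugeConfig d L G → ℝ := fun U => b * (-wilsonAction ρ U) with hfb
  have hSm : Measurable (wilsonAction (d := d) (L := L) ρ) := measurable_wilsonAction ρ hρ
  have hia : Integrable (fun U => Real.exp (fa U)) D := integrable_exp_mul_neg_wilsonAction ρ hρ a
  have hib : Integrable (fun U => Real.exp (fb U)) D := integrable_exp_mul_neg_wilsonAction ρ hρ b
  have hμa : wilsonMeasure (d := d) (L := L) ρ a = D.tilted fa := wilsonMeasure_eq_tilted_neg ρ hρ a
  have hμb : wilsonMeasure (d := d) (L := L) ρ b = D.tilted fb := wilsonMeasure_eq_tilted_neg ρ hρ b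
  have hDb : D ≪ D.tilted fb := absolutelyContinuous_tilted hib
  have hfaν : AEMeasurable fa (D.tilted fb) := (measurable_const.mul hSm.neg).aemeasurable
  have h1 := llr_tilted_left (μ := D) (ν := D.tilted fb) (f := fa) hDb hia hfaν
  have h2 := llr_tilted_right (μ := D) (ν := D) (f := fb) Measure.AbsolutelyContinuous.rfl hib
  have h3 := llr_self D
  have hψa : Real.log (∫ z, Real.exp (fa z) ∂D) = cgf (fun U => -wilsonAction ρ U) D a := rfl
  have hψb : Real.log (∫ z, Real.exp (fb z) ∂D) = cgf (fun U => -wilsonAction ρ U) D b := rfl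
  have hall : llr (D.tilted fa) (D.tilted fb) =ᵐ[D] fun U =>
      (b - a) * wilsonAction ρ U +
        (cgf (fun U => -wilsonAction ρ U) D b - cgf (fun U => -wilsonAction ρ U) D a) := by
    filter_upwards [h1, h2, h3] with U hU1 hU2 hU3
    rw [hU1, hU2, hU3, hψa, hψb, Pi.zero_apply, add_zero, hfa, hfb]
    ring
  rw [hμa, hμb]
  exact (tilted_absolutelyContinuous D fa).ae_le hall

/-- `μ_a ≪ μ_b` for all couplings. [folklore] -/
theorem wilsonMeasure_absolutelyContinuous (hρ : Continuous ρ) (a b : ℝ) :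
    wilsonMeasure (d := d) (L := L) ρ a ≪ wilsonMeasure (d := d) (L := L) ρ b := by
  rw [wilsonMeasure_eq_tilted_neg ρ hρ a, wilsonMeasure_eq_tilted_neg ρ hρ b]
  exact (tilted_absolutelyContinuous _ _).trans
    (absolutelyContinuous_tilted (integrable_exp_mul_neg_wilsonAction ρ hρ b))

/-- The log-likelihood ratio of two couplings is `μ_a`-integrable. [folklore] -/
theorem integrable_llr_wilsonMeasure (hρ : Continuous ρ) (a b : ℝ) :
    Integrable (llr (wilsonMeasure (d := d) (L := L) ρ a) (wilsonMeasure (d := d) (L := L) ρ b))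
      (wilsonMeasure (d := d) (L := L) ρ a) := by
  refine Integrable.congr ?_ (llr_wilsonMeasure_ae_eq (d := d) (L := L) ρ hρ a b).symm
  haveI := isProbabilityMeasure_wilsonMeasure (d := d) (L := L) ρ hρ a
  exact ((integrable_wilsonAction_wilsonMeasure ρ hρ a).const_mul _).add (integrable_const _)

/-- **`D(μ_a ‖ μ_b) < ∞`**. [folklore] -/
theorem klDiv_wilsonMeasure_ne_top (hρ : Continuous ρ) (a b : ℝ) :
    klDiv (wilsonMeasure (d := d) (L := L) ρ a) (wilsonMeasure (d := d) (L := L) ρ b) ≠ ⊤ :=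
  klDiv_ne_top_iff.2 ⟨wilsonMeasure_absolutelyContinuous ρ hρ a b, integrable_llr_wilsonMeasure ρ hρ a b⟩

/-- **`D(μ_a ‖ μ_b) = ψ(b) − ψ(a) + (b − a)·⟨S_W⟩_{μ_a}`**, every compact gauge group, all real `a, b`.
[folklore] -/
theorem toReal_klDiv_wilsonMeasure (hρ : Continuous ρ) (a b : ℝ) :
    (klDiv (wilsonMeasure (d := d) (L := L) ρ a) (wilsonMeasure (d := d) (L := L) ρ b)).toReal =
      cgf (fun U => -wilsonAction ρ U) (trivialMeasure G d L) b -
          cgf (fun U => -wilsonAction ρ U) (trivialMeasure G d L) a +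
        (b - a) * ∫ U, wilsonAction ρ U ∂(wilsonMeasure (d := d) (L := L) ρ a) := by
  haveI := isProbabilityMeasure_wilsonMeasure (d := d) (L := L) ρ hρ a
  haveI := isProbabilityMeasure_wilsonMeasure (d := d) (L := L) ρ hρ b
  rw [toReal_klDiv_of_measure_eq (wilsonMeasure_absolutelyContinuous ρ hρ a b)
    (by rw [measure_univ, measure_univ]), integral_congr_ae (llr_wilsonMeasure_ae_eq ρ hρ a b),
    integral_add ((integrable_wilsonAction_wilsonMeasure ρ hρ a).const_mul _) (integrable_const _),
    MeasureTheory.integral_const_mul, MeasureTheory.integral_const, smul_eq_mul, probReal_univ, one_mul]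
  ring

/-- **BREGMAN FORM: `D(μ_a ‖ μ_b) = ψ(b) − ψ(a) − (b − a)·ψ′(a)`** — the relative entropy between two
couplings is the Bregman divergence of the convex free energy `ψ = log Z`. [folklore] -/
theorem toReal_klDiv_wilsonMeasure_eq_bregman (hρ : Continuous ρ) (a b : ℝ) :
    (klDiv (wilsonMeasure (d := d) (L := L) ρ a) (wilsonMeasure (d := d) (L := L) ρ b)).toReal =
      cgf (fun U => -wilsonAction ρ U) (trivialMeasure G d L) b -
          cgf (fun U => -wilsonAction ρ U) (trivialMeasure G d L) a -
        (b - a) * deriv (cgf (fun U => -wilsonAction ρ U) (trivialMeasure G d L)) a := by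
  rw [toReal_klDiv_wilsonMeasure ρ hρ a b, deriv_cgf_eq_neg_mean ρ hρ a]
  ring

/-- **INTEGRAL FORM: `D(μ_a ‖ μ_b) = ∫_a^b (ψ′(s) − ψ′(a)) ds`** (and `ψ′(s) − ψ′(a) = ∫_a^s Var`,
`deriv_cgf_sub_eq_integral_variance`). [folklore] -/
theorem toReal_klDiv_wilsonMeasure_eq_integral (hρ : Continuous ρ) (a b : ℝ) :
    (klDiv (wilsonMeasure (d := d) (L := L) ρ a) (wilsonMeasure (d := d) (L := L) ρ b)).toReal =
      ∫ s in a..b, (deriv (cgf (fun U => -wilsonAction ρ U) (trivialMeasure G d L)) s -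
        deriv (cgf (fun U => -wilsonAction ρ U) (trivialMeasure G d L)) a) := by
  set ψ := cgf (fun U => -wilsonAction ρ U) (trivialMeasure G d L) with hψ
  have hψ'c : Continuous (deriv ψ) := continuous_iff_continuousAt.2 fun t =>
    (hasDerivAt_deriv_cgf_anyGroup (d := d) (L := L) hρ t).continuousAt
  have h1 : ψ b - ψ a = ∫ t in a..b, deriv ψ t :=
    (integral_eq_sub_of_hasDerivAt (fun t _ => hasDerivAt_cgf_anyGroup (d := d) (L := L) hρ t)
      (hψ'c.intervalIntegrable _ _)).symm
  rw [toReal_klDiv_wilsonMeasure_eq_bregman ρ hρ a b, ← hψ,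
    intervalIntegral.integral_sub (hψ'c.intervalIntegrable _ _) (continuous_const.intervalIntegrable _ _),
    intervalIntegral.integral_const, smul_eq_mul, h1]

/-! ## §2 The Jeffreys identity and the bounds -/

/-- **JEFFREYS IDENTITY, every compact gauge group, all real `a, b`:
`D(μ_a‖μ_b) + D(μ_b‖μ_a) = (b − a)·(ψ′(b) − ψ′(a))`.** [folklore] -/
theorem jeffreys_wilsonMeasure (hρ : Continuous ρ) (a b : ℝ) :
    (klDiv (wilsonMeasure (d := d) (L := L) ρ a) (wilsonMeasure (d := d) (L := L) ρ b)).toReal +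
        (klDiv (wilsonMeasure (d := d) (L := L) ρ b) (wilsonMeasure (d := d) (L := L) ρ a)).toReal =
      (b - a) * (deriv (cgf (fun U => -wilsonAction ρ U) (trivialMeasure G d L)) b -
        deriv (cgf (fun U => -wilsonAction ρ U) (trivialMeasure G d L)) a) := by
  rw [toReal_klDiv_wilsonMeasure_eq_bregman ρ hρ a b, toReal_klDiv_wilsonMeasure_eq_bregman ρ hρ b a]
  ring

/-- **JEFFREYS = (step) × (mean-action drop) = (step) × ∫ Var**:
`D(μ_a‖μ_b) + D(μ_b‖μ_a) = (b − a)·(⟨S_W⟩_a − ⟨S_W⟩_b) = (b − a)·∫_a^b Var_t(S_W) dt`. [folklore] -/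
theorem jeffreys_wilsonMeasure_eq_mean_drop (hρ : Continuous ρ) (a b : ℝ) :
    (klDiv (wilsonMeasure (d := d) (L := L) ρ a) (wilsonMeasure (d := d) (L := L) ρ b)).toReal +
        (klDiv (wilsonMeasure (d := d) (L := L) ρ b) (wilsonMeasure (d := d) (L := L) ρ a)).toReal =
      (b - a) * ((∫ U, wilsonAction ρ U ∂(wilsonMeasure (d := d) (L := L) ρ a)) -
        ∫ U, wilsonAction ρ U ∂(wilsonMeasure (d := d) (L := L) ρ b)) := by
  rw [jeffreys_wilsonMeasure ρ hρ a b, deriv_cgf_eq_neg_mean ρ hρ, deriv_cgf_eq_neg_mean ρ hρ]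
  ring

/-- The same with the fluctuation integral: `J(μ_a, μ_b) = (b − a)·∫_a^b Var_t(S_W^ρ) dt`. [folklore] -/
theorem jeffreys_wilsonMeasure_eq_integral_variance (hρ : Continuous ρ) (a b : ℝ) :
    (klDiv (wilsonMeasure (d := d) (L := L) ρ a) (wilsonMeasure (d := d) (L := L) ρ b)).toReal +
        (klDiv (wilsonMeasure (d := d) (L := L) ρ b) (wilsonMeasure (d := d) (L := L) ρ a)).toReal =
      (b - a) * ∫ t in a..b, variance (wilsonAction (d := d) (L := L) ρ)
        (wilsonMeasure (d := d) (L := L) ρ t) := by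
  rw [jeffreys_wilsonMeasure_eq_mean_drop ρ hρ a b, mean_sub_mean_eq_integral_variance ρ hρ a b]

/-- **COOLING STEP: `D(μ_a ‖ μ_b) ≤ (b − a)·(⟨S_W⟩_a − ⟨S_W⟩_b)`** for all real `a, b` (the other
relative entropy is `≥ 0`; both factors on the right change sign together). [ours] -/
theorem klDiv_wilsonMeasure_le_mean_drop (hρ : Continuous ρ) (a b : ℝ) :
    (klDiv (wilsonMeasure (d := d) (L := L) ρ a) (wilsonMeasure (d := d) (L := L) ρ b)).toReal ≤
      (b - a) * ((∫ U, wilsonAction ρ U ∂(wilsonMeasure (d := d) (L := L) ρ a)) -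
        ∫ U, wilsonAction ρ U ∂(wilsonMeasure (d := d) (L := L) ρ b)) := by
  have h := jeffreys_wilsonMeasure_eq_mean_drop (d := d) (L := L) ρ hρ a b
  have h0 : 0 ≤ (klDiv (wilsonMeasure (d := d) (L := L) ρ b)
      (wilsonMeasure (d := d) (L := L) ρ a)).toReal := ENNReal.toReal_nonneg
  linarith

/-- **HEATING STEP: `D(μ_b ‖ μ_a) ≤ (b − a)·(⟨S_W⟩_a − ⟨S_W⟩_b)`** for all real `a, b`. [ours] -/
theorem klDiv_wilsonMeasure_symm_le_mean_drop (hρ : Continuous ρ) (a b : ℝ) :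
    (klDiv (wilsonMeasure (d := d) (L := L) ρ b) (wilsonMeasure (d := d) (L := L) ρ a)).toReal ≤
      (b - a) * ((∫ U, wilsonAction ρ U ∂(wilsonMeasure (d := d) (L := L) ρ a)) -
        ∫ U, wilsonAction ρ U ∂(wilsonMeasure (d := d) (L := L) ρ b)) := by
  have h := jeffreys_wilsonMeasure_eq_mean_drop (d := d) (L := L) ρ hρ a b
  have h0 : 0 ≤ (klDiv (wilsonMeasure (d := d) (L := L) ρ a)
      (wilsonMeasure (d := d) (L := L) ρ b)).toReal := ENNReal.toReal_nonneg
  linarith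

/-- **VOLUME FORM: `D(μ_a ‖ μ_b) ≤ 2N·#plaq·(b − a)`** and the same for `D(μ_b ‖ μ_a)` (`a ≤ b`), every
compact gauge group, every volume. [ours] -/
theorem klDiv_wilsonMeasure_le_volume (hρ : Continuous ρ) {a b : ℝ} (hab : a ≤ b) :
    (klDiv (wilsonMeasure (d := d) (L := L) ρ a) (wilsonMeasure (d := d) (L := L) ρ b)).toReal ≤
        2 * N * Fintype.card (Plaquette d L) * (b - a) ∧
      (klDiv (wilsonMeasure (d := d) (L := L) ρ b) (wilsonMeasure (d := d) (L := L) ρ a)).toReal ≤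
        2 * N * Fintype.card (Plaquette d L) * (b - a) := by
  have h1 := klDiv_wilsonMeasure_le_mean_drop (d := d) (L := L) ρ hρ a b
  have h2 := klDiv_wilsonMeasure_symm_le_mean_drop (d := d) (L := L) ρ hρ a b
  have hA := mean_wilsonAction_le (d := d) (L := L) ρ hρ a
  have hB := mean_wilsonAction_nonneg (d := d) (L := L) ρ hρ b
  have hab' : 0 ≤ b - a := sub_nonneg.2 hab
  have hdrop : (b - a) * ((∫ U, wilsonAction ρ U ∂(wilsonMeasure (d := d) (L := L) ρ a)) -
      ∫ U, wilsonAction ρ U ∂(wilsonMeasure (d := d) (L := L) ρ b)) ≤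
      2 * N * Fintype.card (Plaquette d L) * (b - a) := by nlinarith
  exact ⟨h1.trans hdrop, h2.trans hdrop⟩

/-- **Jeffreys from a variance floor**: `m ≤ Var_t(S_W)` on `[a, b]` (`a ≤ b`) gives
`m·(b − a)² ≤ D(μ_a‖μ_b) + D(μ_b‖μ_a)`. [ours] -/
theorem jeffreys_ge_of_floor (hρ : Continuous ρ) {a b m : ℝ} (hab : a ≤ b)
    (hm : ∀ t ∈ Icc a b, m ≤ variance (wilsonAction (d := d) (L := L) ρ)
      (wilsonMeasure (d := d) (L := L) ρ t)) :
    m * (b - a) ^ 2 ≤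
      (klDiv (wilsonMeasure (d := d) (L := L) ρ a) (wilsonMeasure (d := d) (L := L) ρ b)).toReal +
        (klDiv (wilsonMeasure (d := d) (L := L) ρ b) (wilsonMeasure (d := d) (L := L) ρ a)).toReal := by
  rw [jeffreys_wilsonMeasure_eq_integral_variance ρ hρ a b]
  have hconst : ∫ _ in a..b, m = (b - a) * m := by
    rw [intervalIntegral.integral_const, smul_eq_mul]
  have hint : (b - a) * m ≤ ∫ t in a..b, variance (wilsonAction (d := d) (L := L) ρ)
      (wilsonMeasure (d := d) (L := L) ρ t) := by
    rw [← hconst]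
    exact intervalIntegral.integral_mono_on hab (continuous_const.intervalIntegrable _ _)
      ((continuous_variance_wilsonMeasure hρ).intervalIntegrable _ _) hm
  have hab' : 0 ≤ b - a := sub_nonneg.2 hab
  nlinarith

/-- **Jeffreys from a variance ceiling**: `Var_t(S_W) ≤ M` on `[a, b]` (`a ≤ b`) gives
`D(μ_a‖μ_b) + D(μ_b‖μ_a) ≤ M·(b − a)²`. [ours] -/
theorem jeffreys_le_of_ceiling (hρ : Continuous ρ) {a b M : ℝ} (hab : a ≤ b)
    (hM : ∀ t ∈ Icc a b, variance (wilsonAction (d := d) (L := L) ρ)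
      (wilsonMeasure (d := d) (L := L) ρ t) ≤ M) :
    (klDiv (wilsonMeasure (d := d) (L := L) ρ a) (wilsonMeasure (d := d) (L := L) ρ b)).toReal +
        (klDiv (wilsonMeasure (d := d) (L := L) ρ b) (wilsonMeasure (d := d) (L := L) ρ a)).toReal ≤
      M * (b - a) ^ 2 := by
  rw [jeffreys_wilsonMeasure_eq_integral_variance ρ hρ a b]
  have hconst : ∫ _ in a..b, M = (b - a) * M := by
    rw [intervalIntegral.integral_const, smul_eq_mul]
  have hint : ∫ t in a..b, variance (wilsonAction (d := d) (L := L) ρ)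
      (wilsonMeasure (d := d) (L := L) ρ t) ≤ (b - a) * M := by
    rw [← hconst]
    exact intervalIntegral.integral_mono_on hab
      ((continuous_variance_wilsonMeasure hρ).intervalIntegrable _ _)
      (continuous_const.intervalIntegrable _ _) hM
  have hab' : 0 ≤ b - a := sub_nonneg.2 hab
  nlinarith

/-! ## §3 Uniform annealing: the symmetrised step entropies telescope -/

/-- **`Σ_{j<k} J(μ_{a+jδ}, μ_{a+(j+1)δ}) = δ·(⟨S_W⟩_a − ⟨S_W⟩_{a+kδ})`** — EXACT, every compact gauge
group, every real `a`, `δ`, every `k`. [ours] -/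
theorem sum_jeffreys_uniform (hρ : Continuous ρ) (a δ : ℝ) (k : ℕ) :
    ∑ j ∈ Finset.range k,
        ((klDiv (wilsonMeasure (d := d) (L := L) ρ (a + j * δ))
            (wilsonMeasure (d := d) (L := L) ρ (a + (j + 1) * δ))).toReal +
          (klDiv (wilsonMeasure (d := d) (L := L) ρ (a + (j + 1) * δ))
            (wilsonMeasure (d := d) (L := L) ρ (a + j * δ))).toReal) =
      δ * ((∫ U, wilsonAction ρ U ∂(wilsonMeasure (d := d) (L := L) ρ a)) -
        ∫ U, wilsonAction ρ U ∂(wilsonMeasure (d := d) (L := L) ρ (a + k * δ))) := by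
  set E : ℝ → ℝ := fun t => ∫ U, wilsonAction ρ U ∂(wilsonMeasure (d := d) (L := L) ρ t) with hE
  have hterm : ∀ j : ℕ, (klDiv (wilsonMeasure (d := d) (L := L) ρ (a + j * δ))
        (wilsonMeasure (d := d) (L := L) ρ (a + (j + 1) * δ))).toReal +
      (klDiv (wilsonMeasure (d := d) (L := L) ρ (a + (j + 1) * δ))
        (wilsonMeasure (d := d) (L := L) ρ (a + j * δ))).toReal =
      -(δ * E (a + (j + 1) * δ)) - -(δ * E (a + j * δ)) := by
    intro j
    rw [jeffreys_wilsonMeasure_eq_mean_drop ρ hρ]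
    simp only [hE]
    ring
  simp_rw [hterm]
  have htel := Finset.sum_range_sub (fun j : ℕ => -(δ * E (a + (j : ℝ) * δ))) k
  simp only [Nat.cast_add, Nat.cast_one, Nat.cast_zero, zero_mul, add_zero] at htel
  rw [htel, hE]
  ring

/-- **`Σ_{j<k} J(μ_{β_j}, μ_{β_{j+1}}) ≤ 2N·#plaq·δ`** along the uniform schedule (`δ ≥ 0`): with
`δ = (b − a)/k`, the summed symmetrised relative entropies of uniform annealing are at most
`2N·#plaq·(b − a)/k` — linear in the volume, every compact gauge group, every coupling window. [ours] -/
theorem sum_jeffreys_uniform_le_volume (hρ : Continuous ρ) (a : ℝ) {δ : ℝ} (hδ : 0 ≤ δ) (k : ℕ) :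
    ∑ j ∈ Finset.range k,
        ((klDiv (wilsonMeasure (d := d) (L := L) ρ (a + j * δ))
            (wilsonMeasure (d := d) (L := L) ρ (a + (j + 1) * δ))).toReal +
          (klDiv (wilsonMeasure (d := d) (L := L) ρ (a + (j + 1) * δ))
            (wilsonMeasure (d := d) (L := L) ρ (a + j * δ))).toReal) ≤
      2 * N * Fintype.card (Plaquette d L) * δ := by
  rw [sum_jeffreys_uniform ρ hρ a δ k]
  have hA := mean_wilsonAction_le (d := d) (L := L) ρ hρ a
  have hB := mean_wilsonAction_nonneg (d := d) (L := L) ρ hρ (a + k * δ)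
  nlinarith

end AnyGroup

end Summit.Ventures.LatticeQCDFlow.TrivializingMaps

end
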